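/-
Copyright (c) 2026. All rights reserved.
Released under Apache 2.0 license as described in the file LICENSE.
Authors: abc-iut cell, prover seat abc-iut-f-101 (gen 5; row «SB′-D2», abc-iut-L4-lead m136), over the statement of
abc-iut-w5-d144 (`LogFrobeniusMonoTelecoreObservables`, p484312) and its embedding lemmas (`…Emb`, `…EmbTS`), the generic
toolkits `DiagramSinkSystems` / `DiagramPathEmbeddings` (this seat), `DiagramChainFamiliesTwoSided` (abc-iut-w5-d144),
`DiagramOverHomotopies` (abc-iut-w6-d025), abc-iut-L4-t5's universal families, abc-iut-w5-d053's `pushFamily`, and this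
seat's gen-2 telecore `monoTelecore` — nothing of those files is re-meant.
-/
import Literature.AnabelianGeometry.AbsoluteAnabelian.LogFrobeniusMonoTelecoreObservablesEmb
import Literature.AnabelianGeometry.AbsoluteAnabelian.LogFrobeniusMonoTelecoreObservablesEmbTS
import Literature.AnabelianGeometry.AbsoluteAnabelian.LogFrobeniusMonoTelecoreOver
import Literature.AnabelianGeometry.AbsoluteAnabelian.LogFrobeniusObservablesTSOfPlus
import Literature.AnabelianGeometry.AbsoluteAnabelian.DiagramShiftInvariance
import HarnessLib

/-!
# [AbsTopIII] Cor 5.10 (iv)(b), last sentence — sufficiency, part 1/3: the shape of `D_{An⊢}` and the embedded observables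

S. Mochizuki, *Topics in absolute anabelian geometry III: global reconstruction algorithms*,
J. Math. Sci. Univ. Tokyo 22 (2015) 939–1156 [MochizukiAbsTopIII2015]; locators `p.N` = pages of the author's manuscript
(`paper:url-5493eb38cbb7`), read on the page: Cor 5.10 (iv)(b) pp. 147–148 ("… give rise to a telecore structure `𝔗_{An⊢}` on
`D•⊢_{≤5} ∪ D•_{≤6}` … Moreover, the respective family of homotopies of `𝔗_{An⊢}` and the observables `S_log`, `S_log⊞` of
Corollary 5.5, (iii), are compatible"), Def 3.5 (ii) p. 75 ("compatible": contained in ONE family with the same homotopies),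
Rmk 3.5.1 p. 78 (a core as "a sort of 'constant portion' of the diagram that lies, in a consistent fashion, 'under the entire
diagram'").

PROOF-SIDE companion (part 1 of 3) of abc-iut-w5-d144's `Cor510MonoTelecoreObservablesCompatible` (`s_b′`, p484312; nothing
there is restated), preparing the abstract sufficiency theorem `cor510MonoTelecoreObservablesCompatible_of`
(`LogFrobeniusMonoTelecoreObservablesOf.lean`, spec `COR510iv-SBprime-CLOSER-SPEC.md` §6 brick D2):

* the combinatorics of `Γ⃗_{D_{An⊢}}` — the flagged vertices `An⊢`, `𝒩⊞_v`, `𝒩_v` of the sink system (`isObsMono`) and a RANK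
  function increasing along the arrows (`rank`, `rank_le_of_path`, `length_eq_zero_of_rank`, `false_of_path_obs`: no arrow of
  `D•⊢` returns towards `□`, `𝒩⊞_v`, `𝒩_v`; nothing leaves the mono-analytic side);
* the observables' diagrams as pull-backs of `D_{An⊢}` (abc-iut-w5-d144's `logDiagramPlus_eq_comapAlong_embMonoPlus` at the
  printed telecore edges) and a family `Hplus v` / `Hts v` read on them (`plusComap`, `tsComap`), its homotopies read on the
  path functors of `D_{An⊢}` (`embPlusHom`, `embTSHom`, with `…_app_heq`: same components);
* the embedded `⊞`-paths pushed along `𝒩⊞_v → 𝒩_v` (`embMonoTS_mapPath_push`: `embMonoTS ∘ plusToTS = embMonoPlus` on paths).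

OUR kernel bookkeeping over a typed interface; nothing here bears on [IUTchIII] Cor. 3.12; no side taken.
-/

set_option autoImplicit false

universe u

open CategoryTheory Quiver

namespace Literature.AnabelianGeometry.AbsoluteAnabelian

namespace LogFrobeniusSetting

open DiagramOfCategories

variable {Vmod : Type u} {isArc : Vmod → Bool} (L : LogFrobeniusSetting Vmod isArc)

/-! ## The combinatorics of `Γ⃗_{D_{An⊢}}`: flagged vertices and a rank function -/

section Shape

/-- The flagged vertices of the sink system: the core vertex `An⊢[𝒩⊢⊞]` and the observation vertices `𝒩⊞_v`, `𝒩_v` of the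
observables. [cite: MochizukiAbsTopIII2015, Cor 5.10 (iv)(b) p. 148] -/
def isObsMono : (monoTeleShape Vmod isArc).Vertex → Bool
  | ExtVertex.obs => true
  | ExtVertex.base ⟨.nplus _, _⟩ => true
  | ExtVertex.base ⟨.nv _, _⟩ => true
  | ExtVertex.base ⟨_, _⟩ => false

/-- A rank on the vertices of `D•⊢` increasing along the arrows: rows 1–2 ↦ 0, `𝒩⊞_v ↦ 1`, `𝒩_v ↦ 2`, everything else ↦ 3.
[cite: MochizukiAbsTopIII2015, Cor 5.5 p. 129] -/
def rankV : DVertex Vmod isArc → ℕ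
  | .row1 _ => 0
  | .core => 0
  | .nplus _ => 1
  | .nv _ => 2
  | _ => 3

/-- The rank on `Γ⃗_{D_{An⊢}}` (`An⊢ ↦ 3`). [cite: MochizukiAbsTopIII2015, Cor 5.10 (iv)(b) p. 147] -/
def rank : (monoTeleShape Vmod isArc).Vertex → ℕ
  | ExtVertex.obs => 3
  | ExtVertex.base x => rankV x.1

/-- Arrows do not decrease the rank. [cite: MochizukiAbsTopIII2015, Cor 5.10 (iv)(b) p. 147] -/
theorem rank_le_of_hom {a b : (monoTeleShape Vmod isArc).Vertex} (e : a ⟶ b) : rank a ≤ rank b := by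
  rcases a with ⟨a, ha⟩ | _ <;> rcases b with ⟨b, hb⟩ | _
  · change DEdge isArc a b at e
    cases e <;> simp [rank, rankV]
  · change DEdge isArc a .anMono at e
    cases e <;> simp [rank, rankV]
  · change MonoTelecoreIdx b at e
    cases b <;> first | exact PEmpty.elim e | simp [rank, rankV]
  · exact PEmpty.elim e

/-- Arrows out of `𝒩⊞_v`, `𝒩_v` strictly increase the rank (they lead to `𝒩_v`, `ℰ•` or the mono-analytic rows).
[cite: MochizukiAbsTopIII2015, Cor 5.10 (iv)(b) p. 147] -/
theorem rank_lt_of_hom {a b : (monoTeleShape Vmod isArc).Vertex} (e : a ⟶ b) (h1 : 1 ≤ rank a) (h2 : rank a ≤ 2) :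
    rank a < rank b := by
  rcases a with ⟨a, ha⟩ | _ <;> rcases b with ⟨b, hb⟩ | _
  · change DEdge isArc a b at e
    cases e <;> simp [rank, rankV] at h1 h2 ⊢
  · change DEdge isArc a .anMono at e
    cases e <;> simp [rank, rankV] at h1 h2 ⊢
  · simp [rank] at h2
  · exact PEmpty.elim e

/-- Paths do not decrease the rank. [cite: MochizukiAbsTopIII2015, Cor 5.10 (iv)(b) p. 147] -/
theorem rank_le_of_path {a b : (monoTeleShape Vmod isArc).Vertex} (p : Path a b) : rank a ≤ rank b := by
  induction p with
  | nil => exact le_rfl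
  | cons p e ih => exact ih.trans (rank_le_of_hom e)

/-- A path out of `𝒩⊞_v` or `𝒩_v` that does not increase the rank is trivial. [cite: MochizukiAbsTopIII2015, Cor 5.10 (iv)(b) p. 147] -/
theorem length_eq_zero_of_rank {a b : (monoTeleShape Vmod isArc).Vertex} (p : Path a b) (hab : rank b ≤ rank a)
    (h1 : 1 ≤ rank a) (h2 : rank a ≤ 2) : p.length = 0 := by
  cases p with
  | nil => rfl
  | cons p e =>
    have hc := rank_le_of_path p
    have he := rank_lt_of_hom e (h1.trans hc) ((hc.antisymm ((rank_le_of_hom e).trans hab)).symm ▸ h2)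
    omega

/-- No path of `Γ⃗_{D_{An⊢}}` runs from the core vertex `An⊢` to a vertex `𝒩⊞_v` or `𝒩_v`.
[cite: MochizukiAbsTopIII2015, Cor 5.10 (iv)(b) p. 147] -/
theorem false_of_path_obs {b : (monoTeleShape Vmod isArc).Vertex} (p : Path (monoTeleShape Vmod isArc).obs b)
    (hb : rank b ≤ 2) : False := by
  have h := rank_le_of_path p
  change 3 ≤ rank b at h
  omega

end Shape

/-! ## The embeddings `Γ⃗(S_log⊞_v) ↪ Γ⃗_{D_{An⊢}} ↩ Γ⃗(S_log_v)` -/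

section Embeddings

variable (v : Vmod)

/-- The printed telecore edges land at mono-analytic vertices only (abc-iut-w5-d144's `hJ` for `monoJ`).
[cite: MochizukiAbsTopIII2015, Cor 5.10 (iv)(b) p. 147] -/
theorem monoJ_isEmpty_of_isHolomorphic (a : DSub (monoBase (Vmod := Vmod) (isArc := isArc) 6))
    (ha : a.1.IsHolomorphic) : IsEmpty (monoJ (Vmod := Vmod) a) :=
  isEmpty_monoTelecoreIdx_of_isHolomorphic a ha

/-- The presentation `S_log⊞_v` IS `D_{An⊢}` pulled back along `embMonoPlus` (abc-iut-w5-d144's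
`logDiagramPlus_eq_comapAlong_embMonoPlus` at the printed telecore edges). [cite: MochizukiAbsTopIII2015, Definition 3.5 (i) p.74] -/
theorem logDiagramPlus_eq_comapAlong :
    L.logDiagramPlus v = L.monoTeleDiagram.comapAlong (embMonoPlus (monoJ (Vmod := Vmod)) v) :=
  L.logDiagramPlus_eq_comapAlong_embMonoPlus monoJ v L.monoTelMap

/-- The presentation `S_log_v` IS `D_{An⊢}` pulled back along `embMonoTS` (abc-iut-w5-d144).
[cite: MochizukiAbsTopIII2015, Definition 3.5 (i) p.74] -/
theorem logDiagramTS_eq_comapAlong :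
    L.logDiagramTS v = L.monoTeleDiagram.comapAlong (embMonoTS (monoJ (Vmod := Vmod)) v) :=
  L.logDiagramTS_eq_comapAlong_embMonoTS monoJ v L.monoTelMap

/-- A family of `S_log⊞_v` read on the pulled-back presentation. [cite: MochizukiAbsTopIII2015, Definition 3.5 (ii) p.75] -/
def plusComap (H : (L.logDiagramPlus v).HomotopyFamily) :
    (L.monoTeleDiagram.comapAlong (embMonoPlus (monoJ (Vmod := Vmod)) v)).HomotopyFamily :=
  L.logDiagramPlus_eq_comapAlong v ▸ H

/-- A family of `S_log_v` read on the pulled-back presentation. [cite: MochizukiAbsTopIII2015, Definition 3.5 (ii) p.75] -/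
def tsComap (H : (L.logDiagramTS v).HomotopyFamily) :
    (L.monoTeleDiagram.comapAlong (embMonoTS (monoJ (Vmod := Vmod)) v)).HomotopyFamily :=
  L.logDiagramTS_eq_comapAlong v ▸ H

/-- Same boundary set. [cite: MochizukiAbsTopIII2015, Definition 3.5 (ii) p.75] -/
theorem plusComap_E_iff (H : (L.logDiagramPlus v).HomotopyFamily) {a b : (logShapePlus (isArc := isArc) v).Vertex}
    (p q : Path a b) : (L.plusComap v H).E p q ↔ H.E p q :=
  DiagramOfCategories.HomotopyFamily.cast_E_iff _ H p q

/-- Same boundary set. [cite: MochizukiAbsTopIII2015, Definition 3.5 (ii) p.75] -/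
theorem tsComap_E_iff (H : (L.logDiagramTS v).HomotopyFamily) {a b : (logShapeTS (isArc := isArc) v).Vertex}
    (p q : Path a b) : (L.tsComap v H).E p q ↔ H.E p q :=
  DiagramOfCategories.HomotopyFamily.cast_E_iff _ H p q

/-- Same homotopies (heterogeneously). [cite: MochizukiAbsTopIII2015, Definition 3.5 (ii) p.75] -/
theorem plusComap_η_heq (H : (L.logDiagramPlus v).HomotopyFamily) {a b : (logShapePlus (isArc := isArc) v).Vertex}
    {p q : Path a b} (h : (L.plusComap v H).E p q) :
    HEq ((L.plusComap v H).η h) (H.η ((L.plusComap_E_iff v H p q).mp h)) :=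
  DiagramOfCategories.HomotopyFamily.cast_η_heq _ H h

/-- Same homotopies (heterogeneously). [cite: MochizukiAbsTopIII2015, Definition 3.5 (ii) p.75] -/
theorem tsComap_η_heq (H : (L.logDiagramTS v).HomotopyFamily) {a b : (logShapeTS (isArc := isArc) v).Vertex}
    {p q : Path a b} (h : (L.tsComap v H).E p q) :
    HEq ((L.tsComap v H).η h) (H.η ((L.tsComap_E_iff v H p q).mp h)) :=
  DiagramOfCategories.HomotopyFamily.cast_η_heq _ H h

/-- **A homotopy of `S_log⊞_v` read inside `D_{An⊢}`**: the homotopy of the embedded pair (on the path functors of `D_{An⊢}`).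
[cite: MochizukiAbsTopIII2015, Cor 5.10 (iv)(b) p. 148] -/
noncomputable def embPlusHom (H : (L.logDiagramPlus v).HomotopyFamily) {a : (logShapePlus (isArc := isArc) v).Vertex}
    {p q : Path a (logShapePlus (isArc := isArc) v).obs} (h : H.E p q) :
    L.monoTeleDiagram.pathFunctor ((embMonoPlus (monoJ (Vmod := Vmod)) v).mapPath p) ⟶
      L.monoTeleDiagram.pathFunctor ((embMonoPlus (monoJ (Vmod := Vmod)) v).mapPath q) :=
  (LiftPair.ofMem (F := embMonoPlus monoJ v) (D := L.monoTeleDiagram) (K := L.plusComap v H)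
    ((L.plusComap_E_iff v H p q).mpr h)).hom

/-- Its components are those of the original homotopy (heterogeneously; all identifications are canonical).
[cite: MochizukiAbsTopIII2015, Cor 5.10 (iv)(b) p. 148] -/
theorem embPlusHom_app_heq (H : (L.logDiagramPlus v).HomotopyFamily) (x : DSub (DVertex.InFirstRows (isArc := isArc) 2))
    {p q : Path ((logShapePlus (isArc := isArc) v).base x) (logShapePlus (isArc := isArc) v).obs} (h : H.E p q)
    (X : (L.logDiagramPlus v).obj ((logShapePlus (isArc := isArc) v).base x)) :
    HEq ((L.embPlusHom v H h).app X) ((H.η h).app X) := by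
  have hD := L.logDiagramPlus_eq_comapAlong v
  rw [embPlusHom, LiftPair.hom_ofMem]
  simp only [NatTrans.comp_app, eqToHom_app]
  refine (DiagramOfCategories.HomotopyFamily.heq_eqToHom_comp_comp_eqToHom _ _ _).trans ?_
  exact NatTrans.app_heq_of_heq rfl HEq.rfl rfl HEq.rfl (DiagramOfCategories.pathFunctor_heq_of_eq hD p).symm
    (DiagramOfCategories.pathFunctor_heq_of_eq hD q).symm (L.plusComap_η_heq v H _) HEq.rfl

/-- **A homotopy of `S_log_v` read inside `D_{An⊢}`**. [cite: MochizukiAbsTopIII2015, Cor 5.10 (iv)(b) p. 148] -/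
noncomputable def embTSHom (H : (L.logDiagramTS v).HomotopyFamily) {a : (logShapeTS (isArc := isArc) v).Vertex}
    {p q : Path a (logShapeTS (isArc := isArc) v).obs} (h : H.E p q) :
    L.monoTeleDiagram.pathFunctor ((embMonoTS (monoJ (Vmod := Vmod)) v).mapPath p) ⟶
      L.monoTeleDiagram.pathFunctor ((embMonoTS (monoJ (Vmod := Vmod)) v).mapPath q) :=
  (LiftPair.ofMem (F := embMonoTS monoJ v) (D := L.monoTeleDiagram) (K := L.tsComap v H)
    ((L.tsComap_E_iff v H p q).mpr h)).hom

/-- Its components are those of the original homotopy (heterogeneously). [cite: MochizukiAbsTopIII2015, Cor 5.10 (iv)(b) p. 148] -/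
theorem embTSHom_app_heq (H : (L.logDiagramTS v).HomotopyFamily) (y : DSub (InPortionThree (isArc := isArc) v))
    {p q : Path ((logShapeTS (isArc := isArc) v).base y) (logShapeTS (isArc := isArc) v).obs} (h : H.E p q)
    (X : (L.logDiagramTS v).obj ((logShapeTS (isArc := isArc) v).base y)) :
    HEq ((L.embTSHom v H h).app X) ((H.η h).app X) := by
  have hD := L.logDiagramTS_eq_comapAlong v
  rw [embTSHom, LiftPair.hom_ofMem]
  simp only [NatTrans.comp_app, eqToHom_app]
  refine (DiagramOfCategories.HomotopyFamily.heq_eqToHom_comp_comp_eqToHom _ _ _).trans ?_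
  exact NatTrans.app_heq_of_heq rfl HEq.rfl rfl HEq.rfl (DiagramOfCategories.pathFunctor_heq_of_eq hD p).symm
    (DiagramOfCategories.pathFunctor_heq_of_eq hD q).symm (L.tsComap_η_heq v H _) HEq.rfl

end Embeddings

/-! ## The `⊞`-paths pushed along `𝒩⊞_v → 𝒩_v`, inside `D_{An⊢}` -/

section PushPaths

variable (v : Vmod)

/-- `Path.cons` respects heterogeneous equality (bookkeeping). [folklore] -/
private theorem cons_heq {V : Type*} [Quiver V] {a a' b b' c c' : V} (ha : a = a') (hb : b = b') (hc : c = c')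
    (p : Path a b) (p' : Path a' b') (e : b ⟶ c) (e' : b' ⟶ c') (hp : HEq p p') (he : HEq e e') :
    HEq (p.cons e) (p'.cons e') := by
  subst ha hb hc; cases hp; cases he; rfl

/-- `Path.nil` respects equality of vertices (bookkeeping). [folklore] -/
private theorem nil_heq {V : Type*} [Quiver V] {a a' : V} (ha : a = a') : HEq (Path.nil : Path a a) (Path.nil : Path a' a') := by
  subst ha; rfl

/-- The two embeddings agree on `Γ⃗(S_log⊞_v) ⊆ Γ⃗(S_log_v)`: vertices. [cite: MochizukiAbsTopIII2015, Cor 5.10 (iv)(b) p. 148] -/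
theorem embMonoTS_plusToTS_obj (a : (logShapePlus (isArc := isArc) v).Vertex) :
    (embMonoTS (monoJ (Vmod := Vmod)) v).obj ((plusToTS v).obj a) = (embMonoPlus (monoJ (Vmod := Vmod)) v).obj a := by
  cases a <;> rfl

/-- … and paths (heterogeneously). [cite: MochizukiAbsTopIII2015, Cor 5.10 (iv)(b) p. 148] -/
theorem embMonoTS_plusToTS_mapPath_heq {a : (logShapePlus (isArc := isArc) v).Vertex} :
    ∀ {b : (logShapePlus (isArc := isArc) v).Vertex} (p : Path a b),
      HEq ((embMonoTS (monoJ (Vmod := Vmod)) v).mapPath ((plusToTS v).mapPath p))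
        ((embMonoPlus (monoJ (Vmod := Vmod)) v).mapPath p)
  | _, Path.nil => nil_heq (embMonoTS_plusToTS_obj v a)
  | _, Path.cons (b := b) (c := c) p e => by
    rw [Prefunctor.mapPath_cons, Prefunctor.mapPath_cons, Prefunctor.mapPath_cons]
    refine cons_heq (embMonoTS_plusToTS_obj v a) (embMonoTS_plusToTS_obj v b) (embMonoTS_plusToTS_obj v c) _ _ _ _
      (embMonoTS_plusToTS_mapPath_heq p) ?_
    cases b with
    | obs => cases c <;> exact (PEmpty.elim e)
    | base y =>
      cases c with
      | base z => rfl
      | obs => rfl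

/-- The arrow `𝒩⊞_v → 𝒩_v` of `Γ⃗_{D_{An⊢}}`. [cite: MochizukiAbsTopIII2015, Cor 5.10 (iv)(b) p. 147] -/
abbrev forgetArrow (hn : monoBase (isArc := isArc) 6 (.nplus v)) (hm : monoBase (isArc := isArc) 6 (.nv v)) :
    (monoTeleShape Vmod isArc).base ⟨.nplus v, hn⟩ ⟶ (monoTeleShape Vmod isArc).base ⟨.nv v, hm⟩ :=
  DEdge.forget v

/-- `rank 𝒩⊞_v = 1`. [cite: MochizukiAbsTopIII2015, Cor 5.10 (iv)(b) p. 147] -/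
theorem rank_base_nplus (hn : monoBase (isArc := isArc) 6 (.nplus v)) :
    rank ((monoTeleShape Vmod isArc).base ⟨.nplus v, hn⟩) = 1 := rfl

/-- `rank 𝒩_v = 2`. [cite: MochizukiAbsTopIII2015, Cor 5.10 (iv)(b) p. 147] -/
theorem rank_base_nv (hm : monoBase (isArc := isArc) 6 (.nv v)) :
    rank ((monoTeleShape Vmod isArc).base ⟨.nv v, hm⟩) = 2 := rfl

/-- **A `⊞`-path pushed along `𝒩⊞_v → 𝒩_v`, embedded, is the embedded `⊞`-path followed by the arrow `𝒩⊞_v → 𝒩_v` of `D_{An⊢}`.**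
[cite: MochizukiAbsTopIII2015, Cor 5.10 (iv)(b) p. 148] -/
theorem embMonoTS_mapPath_push (x : DSub (DVertex.InFirstRows (isArc := isArc) 2))
    (p : Path ((logShapePlus (isArc := isArc) v).base x) (logShapePlus (isArc := isArc) v).obs)
    (hn : monoBase (isArc := isArc) 6 (.nplus v)) (hm : monoBase (isArc := isArc) 6 (.nv v)) :
    (embMonoTS (monoJ (Vmod := Vmod)) v).mapPath (((plusToTS v).mapPath p).cons (forgetEdgeTS v)) =
      ((embMonoPlus (monoJ (Vmod := Vmod)) v).mapPath p).comp
        ((Path.nil : Path ((monoTeleShape Vmod isArc).base ⟨.nplus v, hn⟩) _).cons (forgetArrow v hn hm)) := by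
  rw [Prefunctor.mapPath_cons]
  exact eq_of_heq (cons_heq (embMonoTS_plusToTS_obj v _) rfl rfl _ _ _ _ (embMonoTS_plusToTS_mapPath_heq v p) HEq.rfl)

end PushPaths

end LogFrobeniusSetting

end Literature.AnabelianGeometry.AbsoluteAnabelian
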